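import Summits.AtomisticToContinuum.Crystallization.Theorems.FrustratedLawDichotomyStrainedPatchAffineCutA

/-!
# Strained patch · the AFFINE CUT (DOOR Tᴬ), part 2/2: §4 the g54 recut re-pinned at `‖A‖ ≤ 1/50`, §5 the supplier of (R) `(ROOMᴬ) ∧ (GOODᴬ) ⟹ BalancedRefit … (affBal r) …`,
§6 the record junction (decomp-a2c lens-5 g103 NODE «AffineCut» sha16 260721d31e01af32, critic rows 1635 (c1–c3) / 1637 (C); SPLIT EDITION hand-2 g43: part 1/2 =
`…StrainedPatchAffineCutA` (§0–§3, module docstring of record there); this part = §4–§6 verbatim in the same namespace with the same `open`s.  0 sorry, no new axioms,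
no instances / notation / set_option.)
-/

noncomputable section

namespace Summit.AtomisticToContinuum.Crystallization.Theorems.FrustratedLawDichotomyStrainedPatchAffineCut

open scoped BigOperators Classical RealInnerProductSpace
open Summit.AtomisticToContinuum.Crystallization.Theorems.ChargedEnergyGapNegative (E3)
open Summit.AtomisticToContinuum.Crystallization.Theorems.FrustratedLawDichotomyRangeCut (Sep)
open Summit.AtomisticToContinuum.Crystallization.Theorems.FrustratedLawDichotomyMotifLemmas (GoodAtScale)
open Summit.AtomisticToContinuum.Crystallization.Theorems.FrustratedLawDichotomyAveragingCut (ball mem_ball)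
open Summit.AtomisticToContinuum.Crystallization.Theorems.FrustratedLawDichotomyStrainedPatchHomSplit
open Summit.AtomisticToContinuum.Crystallization.Theorems.FrustratedLawDichotomyStrainedPatchCleanCollar (CleanBall)
open Summit.AtomisticToContinuum.Crystallization.Theorems.FrustratedLawDichotomyStrainedPatchPhaseCut (MonoPhaseBall)
open Summit.AtomisticToContinuum.Crystallization.Theorems.FrustratedLawDichotomyStrainedPatchCoreTube (NearHomIsoAt)
open Summit.AtomisticToContinuum.Crystallization.Theorems.FrustratedLawDichotomyStrainedPatchChartFamilies (ChartBy FamilyLE)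
open Summit.AtomisticToContinuum.Crystallization.Theorems.FrustratedLawDichotomyStrainedPatchChartFamiliesBent
open Summit.AtomisticToContinuum.Crystallization.Theorems.FrustratedLawDichotomyStrainedPatchChartFamiliesPinned
open Summit.AtomisticToContinuum.Crystallization.Theorems.FrustratedLawDichotomyStrainedPatchEnvelopeLaw (dev bends1)
open Summit.AtomisticToContinuum.Crystallization.Theorems.FrustratedLawDichotomyStrainedPatchQuantSlaving (ChartFam SlackTab)
open Summit.AtomisticToContinuum.Crystallization.Theorems.FrustratedLawDichotomyStrainedPatchGradedTube
open Summit.AtomisticToContinuum.Crystallization.Theorems.FrustratedLawDichotomyStrainedPatchWindowFamilies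
open Summit.AtomisticToContinuum.Crystallization.Theorems.FrustratedLawDichotomyStrainedPatchRecutPairs
open Summit.AtomisticToContinuum.Crystallization.Theorems.FrustratedLawDichotomyStrainedPatchRecutKinematics
open Summit.AtomisticToContinuum.Crystallization.Theorems.FrustratedLawDichotomyStrainedPatchRecutBuild
open Summit.AtomisticToContinuum.Crystallization.Theorems.FrustratedLawDichotomyStrainedPatchRecutRecord
open Summit.AtomisticToContinuum.Crystallization.Theorems.FrustratedLawDichotomyStrainedPatchRecutChart
open Summit.AtomisticToContinuum.Crystallization.Theorems.FrustratedLawDichotomyStrainedPatchKernelCut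

/-! ## §4. The g54 recut RE-PINNED at `‖A‖ ≤ 1/50` -/

/-- Conjugation factors at `α = 1/50`: `(q₂, q₃) = (1/200, 1/2000)` inflates to at most `(11/2000, 11/20000)` (`1.0621`, `1.0837 ≤ 11/10`). [formal bookkeeping] -/
theorem conj_factors_le_fifty : (1 / 200 : ℝ) * (1 + 1 / 50) / (1 - 1 / 50) ^ 2 ≤ 11 / 2000 ∧ (1 / 2000 : ℝ) * (1 + 1 / 50) / (1 - 1 / 50) ^ 3 ≤ 11 / 20000 := by
  constructor <;> norm_num

/-- ★ The conjugate of a `𝓑₀` bend by `1 + A`, `‖A‖ ≤ 1/50`, lies in `𝓑₁`. [folklore] -/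
theorem exists_conj_bends1_fifty {b₀ : E3 → E3} (hb : b₀ ∈ bends0) (A : E3 →L[ℝ] E3) (hA : ‖A‖ ≤ 1 / 50) :
    ∃ b₁ ∈ bends1, ∀ v, b₁ (((1 : E3 →L[ℝ] E3) + A) v) = ((1 : E3 →L[ℝ] E3) + A) (b₀ v) := by
  obtain ⟨b₁, hb₁, h⟩ := exists_conj_polyBend (q₂ := 1 / 200) (q₃ := 1 / 2000) (by norm_num) (by norm_num) (by norm_num : (1 / 50 : ℝ) < 1)
    (by simpa [bends0] using hb) A hA
  exact ⟨b₁, by simpa [bends1] using polyBends_mono conj_factors_le_fifty.1 conj_factors_le_fifty.2 hb₁, h⟩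

/-- The recut matrix stays in the `1/4`-box: `9/50 + (1/50)(59/50) ≤ 1/4`. [formal bookkeeping] -/
theorem norm_recut_matrix_sub_one_le_fifty {G A : E3 →L[ℝ] E3} (hG : ‖G - 1‖ ≤ 9 / 50) (hA : ‖A‖ ≤ 1 / 50) :
    ‖((1 : E3 →L[ℝ] E3) + A) * G - 1‖ ≤ 1 / 4 := by
  have hG' : ‖G‖ ≤ 59 / 50 := by
    calc ‖G‖ = ‖(G - 1) + 1‖ := by rw [sub_add_cancel]
      _ ≤ ‖G - 1‖ + ‖(1 : E3 →L[ℝ] E3)‖ := norm_add_le _ _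
      _ ≤ 9 / 50 + 1 := add_le_add hG (by rw [ContinuousLinearMap.one_def]; exact ContinuousLinearMap.norm_id_le)
      _ = 59 / 50 := by norm_num
  have hAG : ‖A * G‖ ≤ 1 / 50 * (59 / 50) := (norm_mul_le _ _).trans (mul_le_mul hA hG' (norm_nonneg _) (by norm_num))
  calc ‖((1 : E3 →L[ℝ] E3) + A) * G - 1‖ = ‖(G - 1) + A * G‖ := by rw [add_mul, one_mul, add_sub_right_comm]
    _ ≤ ‖G - 1‖ + ‖A * G‖ := norm_add_le _ _
    _ ≤ 9 / 50 + 1 / 50 * (59 / 50) := add_le_add hG hAG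
    _ ≤ 1 / 4 := by norm_num

/-- A recut site of norm `≤ 133/10` comes from a chart vector of norm `≤ 68/5` (`133/10 ≤ (1 − 1/50)·68/5 = 13.328`). [formal bookkeeping] -/
theorem norm_le_window_fifty (A : E3 →L[ℝ] E3) (hA : ‖A‖ ≤ 1 / 50) {x : E3} (hx : ‖((1 : E3 →L[ℝ] E3) + A) x‖ ≤ 133 / 10) : ‖x‖ ≤ 68 / 5 := by
  have h := antilipschitz_one_add A hA x
  nlinarith [norm_nonneg x]

/-- A `𝓑₀`-bent image of a skeleton vector of norm `≤ 68/5` has norm `≤ 16` (`13.6 + 13.6²/200 + 13.6³/2000 = 15.78…`). [formal bookkeeping] -/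
theorem norm_bends0_le_sixteen_fifty {b : E3 → E3} (hb : b ∈ bends0) {v : E3} (hv : ‖v‖ ≤ 68 / 5) : ‖b v‖ ≤ 16 := by
  have h := norm_polyBend_le (q₂ := 1 / 200) (q₃ := 1 / 2000) (by simpa [bends0] using hb) v
  have h0 : 0 ≤ ‖v‖ := norm_nonneg v
  have h2 : ‖v‖ ^ 2 ≤ (68 / 5) ^ 2 := pow_le_pow_left₀ h0 hv 2
  have h3 : ‖v‖ ^ 3 ≤ (68 / 5) ^ 3 := pow_le_pow_left₀ h0 hv 3
  nlinarith

/-- The inverse-bend bootstrap on the `68/5` skeleton window: `‖v‖ ≤ ‖b v‖ + 219/100`. [formal bookkeeping] -/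
theorem norm_le_of_bends0_window_fifty {b : E3 → E3} (hb : b ∈ bends0) {v : E3} (hv : ‖v‖ ≤ 68 / 5) : ‖v‖ ≤ ‖b v‖ + 219 / 100 := by
  have h := norm_le_of_polyBend (q₂ := 1 / 200) (q₃ := 1 / 2000) (by simpa [bends0] using hb) (by norm_num) (by norm_num) hv
  have : (1 / 200 : ℝ) * (68 / 5) ^ 2 + 1 / 2000 * (68 / 5) ^ 3 ≤ 219 / 100 := by norm_num
  linarith

/-- ★ SEPARATION OF THE RECUT at `‖A‖ ≤ 1/50`: window separation `3/4` on the bent `16`-window gives `7/10 ≤ (49/50)(3/4)`-separated images of distinct skeleton vectors of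
norm `≤ 68/5`. [folklore] -/
theorem sep_recut_fifty {φ : Bool} {b : E3 → E3} {G : E3 →L[ℝ] E3} {ξ : E3} (hW : WindowSep φ b G ξ 16 (3 / 4)) (hb : b ∈ bends0) (A : E3 →L[ℝ] E3)
    (hA : ‖A‖ ≤ 1 / 50) {v v' : E3} (hv : v ∈ latSet φ G ξ) (hv' : v' ∈ latSet φ G ξ) (hne : v ≠ v') (hR : ‖v‖ ≤ 68 / 5) (hR' : ‖v'‖ ≤ 68 / 5) :
    7 / 10 ≤ dist (((1 : E3 →L[ℝ] E3) + A) (b v)) (((1 : E3 →L[ℝ] E3) + A) (b v')) := by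
  have h := windowSep_recut hW A hA (by norm_num) hv hv' hne (norm_bends0_le_sixteen_fifty hb hR) (norm_bends0_le_sixteen_fifty hb hR')
  linarith

/-- `1 + A` is injective for `‖A‖ ≤ 1/50`. [formal bookkeeping] -/
theorem one_add_injective_fifty (A : E3 →L[ℝ] E3) (hA : ‖A‖ ≤ 1 / 50) {u v : E3} (h : ((1 : E3 →L[ℝ] E3) + A) u = ((1 : E3 →L[ℝ] E3) + A) v) : u = v := by
  have hal := antilipschitz_one_add A hA (u - v)
  rw [map_sub, h, sub_self, norm_zero] at hal
  have h0 : ‖u - v‖ ≤ 0 := by nlinarith [norm_nonneg (u - v)]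
  exact sub_eq_zero.1 (norm_le_zero_iff.1 h0)

/-- ★★ **THE RECUT EXISTS at `‖A‖ ≤ 1/50`** — `…RecutBuild.exists_recut` with the four pinned lemmas replaced by their `1/50` versions (same construction: conjugate bend
`b₁ ∈ 𝓑₁`, injective skeleton `w` of the `133/10`-window of `latSet φ ((1+A)G) ξ`, instance `j ↦ y + b₁ (w j)`: presented, `𝓑₁`-bent, injective, `7/10`-separated). [folklore] -/
theorem exists_recut_fifty {φ : Bool} {b₀ : E3 → E3} {G : E3 →L[ℝ] E3} {ξ : E3} (hb₀ : b₀ ∈ bends0) (hG : ‖G - 1‖ ≤ 9 / 50) (hξ : ‖ξ‖ ≤ 1 / 4)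
    (hW : WindowSep φ b₀ G ξ 16 (3 / 4)) (A : E3 →L[ℝ] E3) (hA : ‖A‖ ≤ 1 / 50) (y : E3) :
    ∃ (b₁ : E3 → E3) (M₁ : ℕ) (w : Fin M₁ → E3) (c₁ : Fin M₁), b₁ ∈ bends1 ∧ (∀ v, b₁ (((1 : E3 →L[ℝ] E3) + A) v) = ((1 : E3 →L[ℝ] E3) + A) (b₀ v)) ∧
      Function.Injective w ∧ Set.range w = {u : E3 | u ∈ latSet φ (((1 : E3 →L[ℝ] E3) + A) * G) ξ ∧ ‖u‖ ≤ 133 / 10} ∧ w c₁ = 0 ∧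
      PresentedBy φ b₁ (((1 : E3 →L[ℝ] E3) + A) * G) ξ (133 / 10) (fun a => y + b₁ (w a)) c₁ ∧
      IsBentBall bends1 (133 / 10) (fun a => y + b₁ (w a)) c₁ ∧ Function.Injective (fun a => y + b₁ (w a)) ∧ Sep (fun a => y + b₁ (w a)) := by
  obtain ⟨b₁, hb₁, hconj⟩ := exists_conj_bends1_fifty hb₀ A hA
  have hG₁ := norm_recut_matrix_sub_one_le_fifty hG hA
  obtain ⟨M₁, w, c₁, hinj, hr, hc⟩ := exists_skeleton φ hG₁ hξ (R := 133 / 10) (by norm_num)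
  have hP := presentedBy_bent (polyBend_zero (q₂ := 11 / 2000) (q₃ := 11 / 20000) (by simpa [bends1] using hb₁)) hG₁ hξ hr hc y
  have hsite : ∀ a, ∃ v ∈ latSet φ G ξ, w a = ((1 : E3 →L[ℝ] E3) + A) v ∧ ‖v‖ ≤ 68 / 5 := by
    intro a
    have ha : w a ∈ Set.range w := ⟨a, rfl⟩
    rw [hr] at ha
    obtain ⟨hlat, hnorm⟩ := ha
    rw [latSet_mul] at hlat
    obtain ⟨v, hv, hva⟩ := hlat
    exact ⟨v, hv, hva.symm, norm_le_window_fifty A hA (by rwa [hva])⟩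
  have hsep : Sep (fun a => y + b₁ (w a)) := by
    intro a a' hne
    obtain ⟨v, hv, hva, hvn⟩ := hsite a
    obtain ⟨v', hv', hva', hvn'⟩ := hsite a'
    have hvv : v ≠ v' := by
      intro h
      exact hne (hinj (by rw [hva, hva', h]))
    have h := sep_recut_fifty hW hb₀ A hA hv hv' hvv hvn hvn'
    simpa only [dist_add_left, hva, hva', hconj] using h
  have hinj₁ : Function.Injective (fun a => y + b₁ (w a)) := by
    intro a a' h
    by_contra hne
    have h7 := hsep a a' hne
    simp only [h, dist_self] at h7
    norm_num at h7
  exact ⟨b₁, M₁, w, c₁, hb₁, hconj, hinj, hr, hc, hP, isBentBall_of_presentedBy hb₁ hP, hinj₁, hsep⟩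

/-- The two pinned inequalities of the refit chart: deviation `1/25 + (3/160)(63/10 + 1/25) ≤ 4/25` and covering `63/10 − 4/25 ≤ (1 − 3/160)(63/10 − 1/25)`
(`6.14 ≤ 6.1426`). [formal bookkeeping] -/
theorem tauA_arith : (1 / 25 : ℝ) + 3 / 160 * (63 / 10 + 1 / 25) ≤ 4 / 25 ∧ (63 / 10 : ℝ) - 4 / 25 ≤ (1 - 3 / 160) * (63 / 10 - 1 / 25) := by
  constructor <;> norm_num

/-- ★★ **THE RECUT CHARTS THE CLUSTER, GRADEDLY, AND RELABELS BY `1 + A`** — `…RecutChart.chartBy_recut` re-pinned to the graded junction: data a coarse chart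
(`ChartBy 𝓘₀ (1/25) (1/25) … e₀`, `z₀` injective) presented through a skeleton `s` with bend `b₀ ∈ 𝓑₀`; `‖A‖ ≤ 3/160`; a bend `b₁` (`b₁ 0 = 0`) conjugate to `b₀`; an injective
skeleton `w` of the recut window (`w c₁ = 0`).  Conclusion: the instance `j ↦ y + b₁ (w j)` — if in `𝓘₁` — charts `z` GRADEDLY at `(4/25, affTol (1/25) (1/52))` through
`e₁ a := idxOf w c₁ ((1+A)(s (e₀ a) − s c₀))`, AND on the `63/10`-ball `z₁ (e₁ a) − z₁ c₁ = (1+A)(z₀ (e₀ a) − z₀ c₀)`. [folklore] -/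
theorem chartByG_recutA {𝓘₀ 𝓘₁ : ChartFam} {M : ℕ} {z : Fin M → E3} {c : Fin M} {M₀ : ℕ} {z₀ : Fin M₀ → E3} {c₀ : Fin M₀} {e₀ : Fin M → Fin M₀}
    (hch : ChartBy 𝓘₀ (1 / 25) (1 / 25) z c z₀ c₀ e₀) (hinj₀ : Function.Injective z₀)
    {φ : Bool} {b₀ : E3 → E3} {G : E3 →L[ℝ] E3} {ξ : E3} (hb₀ : b₀ ∈ bends0) {s : Fin M₀ → E3}
    (hs : Set.range s = homRange φ G ξ (133 / 10) (s c₀)) (hzs : ∀ k, z₀ k - z₀ c₀ = b₀ (s k - s c₀))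
    (A : E3 →L[ℝ] E3) (hA : ‖A‖ ≤ 3 / 160) {b₁ : E3 → E3} (hb₁0 : b₁ 0 = 0)
    (hconj : ∀ v, b₁ (((1 : E3 →L[ℝ] E3) + A) v) = ((1 : E3 →L[ℝ] E3) + A) (b₀ v)) {M₁ : ℕ} {w : Fin M₁ → E3} {c₁ : Fin M₁}
    (hwinj : Function.Injective w) (hwr : Set.range w = {u : E3 | u ∈ latSet φ (((1 : E3 →L[ℝ] E3) + A) * G) ξ ∧ ‖u‖ ≤ 133 / 10}) (hwc : w c₁ = 0)
    (y : E3) (hmem : 𝓘₁ M₁ (fun j => y + b₁ (w j)) c₁) :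
    ChartByG 𝓘₁ tauA (affTol (1 / 25) (1 / 52)) z c (fun j => y + b₁ (w j)) c₁ (fun a => idxOf w c₁ (((1 : E3 →L[ℝ] E3) + A) (s (e₀ a) - s c₀))) ∧
      ∀ a, dist (z a) (z c) ≤ 63 / 10 →
        (y + b₁ (w (idxOf w c₁ (((1 : E3 →L[ℝ] E3) + A) (s (e₀ a) - s c₀))))) - (y + b₁ (w c₁)) = ((1 : E3 →L[ℝ] E3) + A) (z₀ (e₀ a) - z₀ c₀) := by
  obtain ⟨-, hec, hcoarse, -, heinj, hcov⟩ := hch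
  have hA50 : ‖A‖ ≤ 1 / 50 := hA.trans (by norm_num)
  -- the chart's skeleton vectors
  have hσ : ∀ k, s k - s c₀ ∈ latSet φ G ξ ∧ ‖s k - s c₀‖ ≤ 133 / 10 := by
    intro k
    have hk : s k ∈ homRange φ G ξ (133 / 10) (s c₀) := hs ▸ ⟨k, rfl⟩
    rw [mem_homRange_iff, dist_eq_norm] at hk
    exact ⟨hk.2, hk.1⟩
  -- a skeleton vector whose bent image is short is a recut-window label
  have hwin : ∀ k, ‖b₀ (s k - s c₀)‖ ≤ 63 / 10 + 1 / 25 → ∃ j, w j = ((1 : E3 →L[ℝ] E3) + A) (s k - s c₀) := by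
    intro k hk
    have hmem' : ((1 : E3 →L[ℝ] E3) + A) (s k - s c₀) ∈ Set.range w := by
      rw [hwr]
      refine ⟨?_, ?_⟩
      · rw [latSet_mul]; exact ⟨s k - s c₀, (hσ k).1, rfl⟩
      · have hb := norm_le_of_bends0_window hb₀ (hσ k).2
        have h1A := norm_one_add_le A hA
        have happ := (((1 : E3 →L[ℝ] E3) + A).le_opNorm (s k - s c₀))
        have : ‖((1 : E3 →L[ℝ] E3) + A)‖ * ‖s k - s c₀‖ ≤ (1 + 3 / 160) * (63 / 10 + 1 / 25 + 21 / 10) :=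
          mul_le_mul h1A (by linarith) (norm_nonneg _) (by norm_num)
        linarith
    exact hmem'
  -- the bent image of the chart label of a ball site is short
  have hshort : ∀ a, dist (z a) (z c) ≤ 63 / 10 → ‖b₀ (s (e₀ a) - s c₀)‖ ≤ 63 / 10 + 1 / 25 := by
    intro a ha
    have hd := hcoarse a ha
    rw [hzs] at hd
    have htri : ‖b₀ (s (e₀ a) - s c₀)‖ ≤ ‖z a - z c‖ + dist (z a - z c) (b₀ (s (e₀ a) - s c₀)) := by
      rw [dist_eq_norm]
      calc ‖b₀ (s (e₀ a) - s c₀)‖ = ‖(z a - z c) - ((z a - z c) - b₀ (s (e₀ a) - s c₀))‖ := by rw [sub_sub_cancel]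
        _ ≤ ‖z a - z c‖ + ‖(z a - z c) - b₀ (s (e₀ a) - s c₀)‖ := norm_sub_le _ _
    have hp : ‖z a - z c‖ ≤ 63 / 10 := by rw [← dist_eq_norm]; exact ha
    linarith
  -- the relabelled site difference is `(1+A)` of the chart site difference
  have hdiff : ∀ a, dist (z a) (z c) ≤ 63 / 10 →
      (y + b₁ (w (idxOf w c₁ (((1 : E3 →L[ℝ] E3) + A) (s (e₀ a) - s c₀))))) - (y + b₁ (w c₁)) =
        ((1 : E3 →L[ℝ] E3) + A) (z₀ (e₀ a) - z₀ c₀) := by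
    intro a ha
    rw [apply_idxOf c₁ (hwin (e₀ a) (hshort a ha)), hconj, hwc, hb₁0, add_zero, add_sub_cancel_left, hzs]
  -- graded deviation `≤ 1/25 + (3/160)‖x‖`, coarse `≤ 4/25`
  have hgrade : ∀ a, dist (z a) (z c) ≤ 63 / 10 →
      dist (z a - z c) ((y + b₁ (w (idxOf w c₁ (((1 : E3 →L[ℝ] E3) + A) (s (e₀ a) - s c₀))))) - (y + b₁ (w c₁))) ≤ 1 / 25 + 3 / 160 * ‖z₀ (e₀ a) - z₀ c₀‖ := by
    intro a ha
    rw [hdiff a ha]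
    have hd := hcoarse a ha
    have hAq : dist (z₀ (e₀ a) - z₀ c₀) (((1 : E3 →L[ℝ] E3) + A) (z₀ (e₀ a) - z₀ c₀)) ≤ 3 / 160 * ‖z₀ (e₀ a) - z₀ c₀‖ :=
      (dist_one_add_apply_le A _).trans (mul_le_mul_of_nonneg_right hA (norm_nonneg _))
    have htri := dist_triangle (z a - z c) (z₀ (e₀ a) - z₀ c₀) (((1 : E3 →L[ℝ] E3) + A) (z₀ (e₀ a) - z₀ c₀))
    linarith
  have hdev : ∀ a, dist (z a) (z c) ≤ 63 / 10 →
      dist (z a - z c) ((y + b₁ (w (idxOf w c₁ (((1 : E3 →L[ℝ] E3) + A) (s (e₀ a) - s c₀))))) - (y + b₁ (w c₁))) ≤ tauA := by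
    intro a ha
    have hq : ‖z₀ (e₀ a) - z₀ c₀‖ ≤ 63 / 10 + 1 / 25 := by rw [hzs]; exact hshort a ha
    have h := hgrade a ha
    simp only [tauA]
    nlinarith [tauA_arith.1]
  refine ⟨⟨⟨hmem, ?_, hdev, fun a ha _ => hdev a ha, ?_, ?_⟩, ?_⟩, hdiff⟩
  · -- centre to centre
    refine idxOf_eq hwinj c₁ ?_
    rw [hec, sub_self, map_zero, hwc]
  · -- injective on the ball
    intro a b ha hb hab
    have hwa := apply_idxOf c₁ (hwin (e₀ a) (hshort a ha))
    have hwb := apply_idxOf c₁ (hwin (e₀ b) (hshort b hb))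
    have hab' : idxOf w c₁ (((1 : E3 →L[ℝ] E3) + A) (s (e₀ a) - s c₀)) = idxOf w c₁ (((1 : E3 →L[ℝ] E3) + A) (s (e₀ b) - s c₀)) := hab
    rw [hab'] at hwa
    have hσab : s (e₀ a) - s c₀ = s (e₀ b) - s c₀ := one_add_injective_fifty A hA50 (hwa.symm.trans hwb)
    have hz : z₀ (e₀ a) = z₀ (e₀ b) := by
      have h := hzs (e₀ a)
      rw [hσab, ← hzs (e₀ b)] at h
      exact sub_left_injective h
    exact heinj a b ha hb (hinj₀ hz)
  · -- covering the instance's (63/10 − 4/25)-ball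
    intro j₁ hj₁
    have hwj : w j₁ ∈ Set.range w := ⟨j₁, rfl⟩
    rw [hwr] at hwj
    obtain ⟨hlat, hnorm⟩ := hwj
    rw [latSet_mul] at hlat
    obtain ⟨u, hu, huj⟩ := hlat
    have hu68 : ‖u‖ ≤ 68 / 5 := norm_le_window_fifty A hA50 (by rw [huj]; exact hnorm)
    have hz₁ : (y + b₁ (w j₁)) - (y + b₁ (w c₁)) = ((1 : E3 →L[ℝ] E3) + A) (b₀ u) := by
      rw [hwc, hb₁0, add_zero, add_sub_cancel_left, ← huj, hconj]
    rw [dist_eq_norm, hz₁] at hj₁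
    have hal := antilipschitz_one_add A hA (b₀ u)
    have hbu : ‖b₀ u‖ ≤ 63 / 10 - 1 / 25 := by
      have h2 := tauA_arith.2
      simp only [tauA] at hj₁
      nlinarith
    have hu13 : ‖u‖ ≤ 133 / 10 := by
      have h := norm_le_of_bends0_window_fifty hb₀ hu68
      linarith
    -- `s c₀ + u` is a chart skeleton point
    have hsu : s c₀ + u ∈ Set.range s := by
      rw [hs, mem_homRange_iff, dist_eq_norm, add_sub_cancel_left]
      exact ⟨hu13, hu⟩
    obtain ⟨k, hk⟩ := hsu
    have hσk : s k - s c₀ = u := by rw [hk, add_sub_cancel_left]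
    have hdk : dist (z₀ k) (z₀ c₀) ≤ 63 / 10 - 1 / 25 := by rw [dist_eq_norm, hzs, hσk]; exact hbu
    obtain ⟨a, ha, hea⟩ := hcov k hdk
    refine ⟨a, ha, ?_⟩
    show idxOf w c₁ (((1 : E3 →L[ℝ] E3) + A) (s (e₀ a) - s c₀)) = j₁
    rw [hea, hσk]
    exact idxOf_eq hwinj c₁ huj.symm
  · -- the graded clause: `1/25 + (3/160)‖x‖ ≤ 1/25 + (1/52)‖(1+A)x‖`
    intro a ha
    have h := hgrade a ha
    have hal := antilipschitz_one_add A hA (z₀ (e₀ a) - z₀ c₀)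
    have hΔ : dist (y + b₁ (w (idxOf w c₁ (((1 : E3 →L[ℝ] E3) + A) (s (e₀ a) - s c₀))))) (y + b₁ (w c₁)) =
        ‖((1 : E3 →L[ℝ] E3) + A) (z₀ (e₀ a) - z₀ c₀)‖ := by
      rw [dist_eq_norm, hdiff a ha]
    show dist (z a - z c) ((y + b₁ (w (idxOf w c₁ (((1 : E3 →L[ℝ] E3) + A) (s (e₀ a) - s c₀))))) - (y + b₁ (w c₁))) ≤
      1 / 25 + 1 / 52 * dist (y + b₁ (w (idxOf w c₁ (((1 : E3 →L[ℝ] E3) + A) (s (e₀ a) - s c₀))))) (y + b₁ (w c₁))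
    rw [hΔ]
    nlinarith [norm_nonneg (z₀ (e₀ a) - z₀ c₀), norm_nonneg (((1 : E3 →L[ℝ] E3) + A) (z₀ (e₀ a) - z₀ c₀))]

/-! ## §5. ★★★ The supplier of (R): `(ROOMᴬ) ∧ (GOODᴬ) ⟹ BalancedRefit … (affBal r) …` -/

/-- The coarse clause of a graded chart bounds the deviation on any `r`-ball, `r ≤ 63/10`. [formal bookkeeping] -/
theorem norm_dev_le_of_chartByG {𝓘₀ : ChartFam} {τ₀ : ℝ} {T₀ : SlackTab} {M : ℕ} {z : Fin M → E3} {c : Fin M} {M₀ : ℕ} {z₀ : Fin M₀ → E3} {c₀ : Fin M₀}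
    {e : Fin M → Fin M₀} (hch : ChartByG 𝓘₀ τ₀ T₀ z c z₀ c₀ e) {r : ℝ} (hr : r ≤ 63 / 10) {a : Fin M} (ha : a ∈ ball r z c) : ‖dev z c z₀ c₀ e a‖ ≤ τ₀ := by
  have ha' : dist (z a) (z c) ≤ 63 / 10 := ((mem_ball).1 ha).trans hr
  have h := hch.1.2.2.1 a ha'
  rwa [dist_eq_norm] at h

/-- ★★★ **THE AFFINE BALANCED REFIT** — for a source family inside `𝓘₀ᴿʷ = ChartFamilyRW` (the g54 footprint: presented `𝓑₀`-bent `133/10`-windows, matrix box `9/50`,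
window separation `3/4` on the bent `16`-window), the host-geometry room (ROOMᴬ)_κ with `κ ≤ 15/32` and the goodness transport (GOODᴬ)_η₁ give (R) of `…KernelCutA` with
TARGET `compFamilyW 𝓑₁ η₁`, BALANCE `affBal r` (EXACT affine moment balance on the `r`-ball, `r ≤ 63/10`), isometry slot `R = 1`, refit tolerances
`(4/25, affTol (1/25) (1/52))` — generic in `(ρ, ε, η₂, T₀)`.  Construction: `A :=` the closed-form least-squares matrix `lsMat` of the chart's deviation field on the
ball (`‖A‖ ≤ κτ₀ ≤ 3/160`), the g54 recut of the coarse host by `A` centred at the old centre, labels through the skeleton; balance by `lsMat_balanced` transported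
through `dev₁ = d − A x`, `z₁ (e₁ a) − z₁ c₁ = (1+A) x`. [folklore] -/
theorem balancedRefit_affBal_of_room {𝓘_N : ChartFam} (hN : FamilyLE 𝓘_N ChartFamilyRW) {r κ : ℝ} (hr : r ≤ 63 / 10) (hκ0 : 0 ≤ κ) (hκ : κ ≤ 15 / 32)
    {T₀ : SlackTab} (hR : MomentRoom 𝓘_N r κ (1 / 25) T₀) {η₁ : ℝ} (hG : RecutGoodA 𝓘_N η₁) {ρ ε η₂ : ℝ} :
    BalancedRefit 𝓘_N (compFamilyW bends1 η₁) (affBal r) ρ ε η₂ (1 / 25) T₀ tauA (affTol (1 / 25) (1 / 52)) := by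
  intro M z c M₀ z₀ c₀ e hz hcl hm _ _ hchG
  have hI : ChartFamilyRW M₀ z₀ c₀ := hN M₀ z₀ c₀ hchG.1.1
  have hinj₀ : Function.Injective z₀ := hI.1.1.1
  obtain ⟨φ, b₀, G, ξ, hb₀, hP₀, hGm, hξ, hW⟩ := hI.2
  obtain ⟨Y, hXY, hYs, hY⟩ := hR M z c M₀ z₀ c₀ e hz hcl hm hchG
  -- the least-squares matrix of the deviation field on the ball
  have hd : ∀ b ∈ ball r z c, ‖dev z c z₀ c₀ e b‖ ≤ 1 / 25 := fun b hb => norm_dev_le_of_chartByG hchG hr hb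
  have hA : ‖lsMat (ball r z c) (fun a => z₀ (e a) - z₀ c₀) (fun a => dev z c z₀ c₀ e a) Y‖ ≤ 3 / 160 :=
    (norm_lsMat_le hYs (by norm_num) hκ0 hd hY).trans (by nlinarith)
  set A : E3 →L[ℝ] E3 := lsMat (ball r z c) (fun a => z₀ (e a) - z₀ c₀) (fun a => dev z c z₀ c₀ e a) Y with hAdef
  -- the recut of the coarse host by `A`, centred at the old centre
  obtain ⟨b₁, M₁, w, c₁, hb₁, hconj, hwinj, hwr, hwc, -, hbent, hinj₁, hsep⟩ :=
    exists_recut_fifty hb₀ hGm (hξ.trans (by norm_num [xi0])) (by simpa only [sep0] using hW) A (hA.trans (by norm_num)) (z₀ c₀)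
  have hb₁0 : b₁ 0 = 0 := polyBend_zero (q₂ := 11 / 2000) (q₃ := 11 / 20000) (by simpa [bends1] using hb₁)
  obtain ⟨-, -, s, hs, hzs⟩ := hP₀
  have hz₁c : (fun j => z₀ c₀ + b₁ (w j)) c₁ = z₀ c₀ := by simp only [hwc, hb₁0, add_zero]
  have hRO : RecutOf A z₀ c₀ (fun j => z₀ c₀ + b₁ (w j)) c₁ e (fun a => idxOf w c₁ (((1 : E3 →L[ℝ] E3) + A) (s (e a) - s c₀))) :=
    ⟨φ, b₀, b₁, G, ξ, s, w, hb₀, hb₁, hs, hzs, hconj, hwinj, hwr, hwc, fun j => by rw [hz₁c], fun a => rfl⟩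
  have hgood₁ : GoodAtScale η₁ (3 / 2) (fun j => z₀ c₀ + b₁ (w j)) c₁ := hG M₀ z₀ c₀ hchG.1.1 A hA _ _ _ _ _ _ hRO hz₁c
  have hmem : compFamilyW bends1 η₁ M₁ (fun j => z₀ c₀ + b₁ (w j)) c₁ := compFamilyW_of_sepBent subset_rfl hinj₁ hsep hbent hgood₁
  obtain ⟨hch₁, hlab⟩ := chartByG_recutA hchG.1 hinj₀ hb₀ hs hzs A hA hb₁0 hconj hwinj hwr hwc (z₀ c₀) hmem
  have hcomp : (⇑(LinearIsometryEquiv.refl ℝ E3) ∘ z) = z := funext fun _ => rfl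
  refine ⟨LinearIsometryEquiv.refl ℝ E3, M₁, fun j => z₀ c₀ + b₁ (w j), c₁, fun a => idxOf w c₁ (((1 : E3 →L[ℝ] E3) + A) (s (e a) - s c₀)), ?_, ?_⟩
  · rw [hcomp]; exact hch₁
  · rw [hcomp]
    intro L
    have key : ∀ a ∈ ball r z c,
        ⟪dev z c (fun j => z₀ c₀ + b₁ (w j)) c₁ (fun a => idxOf w c₁ (((1 : E3 →L[ℝ] E3) + A) (s (e a) - s c₀))) a,
          L ((fun j => z₀ c₀ + b₁ (w j)) ((fun a => idxOf w c₁ (((1 : E3 →L[ℝ] E3) + A) (s (e a) - s c₀))) a) - (fun j => z₀ c₀ + b₁ (w j)) c₁)⟫ =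
        ⟪dev z c z₀ c₀ e a - A (z₀ (e a) - z₀ c₀), (L.comp ((1 : E3 →L[ℝ] E3) + A)) (z₀ (e a) - z₀ c₀)⟫ := by
      intro a ha
      have ha' : dist (z a) (z c) ≤ 63 / 10 := ((mem_ball).1 ha).trans hr
      have hl := hlab a ha'
      have hdev₁ : dev z c (fun j => z₀ c₀ + b₁ (w j)) c₁ (fun a => idxOf w c₁ (((1 : E3 →L[ℝ] E3) + A) (s (e a) - s c₀))) a =
          dev z c z₀ c₀ e a - A (z₀ (e a) - z₀ c₀) := by
        simp only [dev]
        rw [hl, show ((1 : E3 →L[ℝ] E3) + A) (z₀ (e a) - z₀ c₀) = (z₀ (e a) - z₀ c₀) + A (z₀ (e a) - z₀ c₀) from rfl]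
        abel
      rw [hdev₁, ContinuousLinearMap.comp_apply]
      exact congrArg _ (congrArg _ hl)
    rw [Finset.sum_congr rfl key]
    exact lsMat_balanced hXY hYs _

/-- (R) is monotone in the target family. [formal bookkeeping] -/
theorem BalancedRefit.mono_target {𝓘₀ 𝓘 𝓘' : ChartFam} {𝓑 : BalPred} {ρ ε η₂ τ₀ : ℝ} {T₀ : SlackTab} {τ₁ : ℝ} {T₁ : SlackTab}
    (h : BalancedRefit 𝓘₀ 𝓘 𝓑 ρ ε η₂ τ₀ T₀ τ₁ T₁) (hle : FamilyLE 𝓘 𝓘') : BalancedRefit 𝓘₀ 𝓘' 𝓑 ρ ε η₂ τ₀ T₀ τ₁ T₁ := by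
  intro M z c M₀ z₀ c₀ e hz hcl hm hn hg hch
  obtain ⟨R, M₁, z₁, c₁, e₁, hch₁, hb⟩ := h M z c M₀ z₀ c₀ e hz hcl hm hn hg hch
  exact ⟨R, M₁, z₁, c₁, e₁, hch₁.mono_family hle, hb⟩

/-- (R) is antitone in the source family. [formal bookkeeping] -/
theorem BalancedRefit.anti_source {𝓘₀ 𝓘₀' 𝓘 : ChartFam} {𝓑 : BalPred} {ρ ε η₂ τ₀ : ℝ} {T₀ : SlackTab} {τ₁ : ℝ} {T₁ : SlackTab}
    (h : BalancedRefit 𝓘₀' 𝓘 𝓑 ρ ε η₂ τ₀ T₀ τ₁ T₁) (hle : FamilyLE 𝓘₀ 𝓘₀') : BalancedRefit 𝓘₀ 𝓘 𝓑 ρ ε η₂ τ₀ T₀ τ₁ T₁ := by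
  intro M z c M₀ z₀ c₀ e hz hcl hm hn hg hch
  exact h M z c M₀ z₀ c₀ e hz hcl hm hn hg (hch.mono_family hle)

/-! ## §6. The record junction `(26/5, 1/100, 1/8, 1/25, constTol (1/25))`, `r = 24/5` -/

/-- ★★★ **RECORD: the affine balanced refit into `𝓘₁ʷ = CompFamilyW` EXACTLY** — `(ROOMᴬ)_{15/32}` on the `24/5`-ball and `(GOODᴬ)_{η₃₀}` for a source family inside
`𝓘₀ᴿʷ` give `BalancedRefit 𝓘_N CompFamilyW (affBal (24/5)) (26/5) (1/100) (1/8) (1/25) (constTol (1/25)) (4/25) (affTol (1/25) (1/52))`. [folklore] -/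
theorem balancedRefit_affBal_record {𝓘_N : ChartFam} (hN : FamilyLE 𝓘_N ChartFamilyRW) {κ : ℝ} (hκ0 : 0 ≤ κ) (hκ : κ ≤ 15 / 32)
    (hR : MomentRoom 𝓘_N (24 / 5) κ (1 / 25) (constTol (1 / 25))) (hG : RecutGoodA 𝓘_N eta30) :
    BalancedRefit 𝓘_N CompFamilyW (affBal (24 / 5)) (26 / 5) (1 / 100) (1 / 8) (1 / 25) (constTol (1 / 25)) tauA (affTol (1 / 25) (1 / 52)) :=
  balancedRefit_affBal_of_room hN (by norm_num) hκ0 hκ hR hG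

/-- ★★ **RECORD, ROTATION BALANCE** — the tree's advertised piece (R) at `(rotBalanced (24/5), τ₁ = 4τ₀ = 4/25)` of g86 `…KernelCutA` («ATTACKABLE · KNOWN-MATH»), now a
COROLLARY (modulo (ROOMᴬ), (GOODᴬ)): affine balance refines rotation balance. [folklore] -/
theorem balancedRefit_rot_record {𝓘_N : ChartFam} (hN : FamilyLE 𝓘_N ChartFamilyRW) {κ : ℝ} (hκ0 : 0 ≤ κ) (hκ : κ ≤ 15 / 32)
    (hR : MomentRoom 𝓘_N (24 / 5) κ (1 / 25) (constTol (1 / 25))) (hG : RecutGoodA 𝓘_N eta30) :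
    BalancedRefit 𝓘_N CompFamilyW (rotBalanced (24 / 5)) (26 / 5) (1 / 100) (1 / 8) (1 / 25) (constTol (1 / 25)) tauA (affTol (1 / 25) (1 / 52)) :=
  (balancedRefit_affBal_record hN hκ0 hκ hR hG).mono_bal (balLE_affBal_rot _)

end Summit.AtomisticToContinuum.Crystallization.Theorems.FrustratedLawDichotomyStrainedPatchAffineCut

end
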